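import Summits.CriticalPhenomena.PercolationContinuityZ3.Theorems.PercNearOneGluingNoHeavyLowerTailKnQuestion8PocketSetDual
import Summits.CriticalPhenomena.PercolationContinuityZ3.Theorems.PercNearOneGluingNoHeavyLowerTailKnQuestion8PocketSetAttach
import HarnessLib

/-!
# KN Question 8 / MC-D at three relays — (Z*D) = BHK-Z (proved) + PCOV-Z; (41) from FOUR covariance comparisons at `F = 1{b ∈ ·}`

Support file (`--supports stmt-CriticalPhenomena-4575`, closed), prover `prim-lf-2` (gen 17).  No definitions, no named facts, no sorries;
standard axioms.  Memo `prim-lf-2/POCKET-SETDUAL-gen17.md` §3; companions `…KnQuestion8PocketSetDual.lean`, `…PocketSetAttach.lean`,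
`…PocketSetAssembly.lean`.  By the set-cluster duality (`PocketCert.zhalf_of_setHalf`) the half (P1*D⁺) behind (Z*D) is a statement about
the AVOIDED cluster `C_z` on the events `W1 = {x↔o,x↮y,x↮z}`, `W3 = {x↔o,x↔y,x↮z}`, `P∩E1 = {C_o∈𝒟,x↮y,x↮z}`, `P∩F = {C_o∈𝒟,x↔y,x↮z}`,
and the real-arithmetic identity `PocketCert.p1star_pocket_of_pieces` splits it exactly like the observer half:
* `PocketCert.attachZ_of_pocket` — **(BHK-Z), proved for every pocket family**: `μ(P∩E1)·∫_{W1} F(C z) ≤ μ(W1)·∫_{P∩E1} F(C z)` (the weak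
  relay's cluster is stochastically larger under the pocket cell than under the observer world; dual of `attach_of_pocket_union`);
* `PocketCert.zhalfZ_of_pcovZ` — the `x`-part of (Z*D) from (BHK-Z) and **PCOV-Z_x**:
  `mDE2·((mDE1+mDF)·(JxoE1+JxoF) − (a+d)·(JDE1+JDF)) ≤ b·(mDE1·JDF − mDF·JDE1)`, `J_E = ∫_E F(C z)` (PCOV reversed, owner functional
  replaced by the weak relay's);
* `PocketCert.block41_three_of_pcovZ` — **(41) for three relays from PCOV_x, PCOV_y, PCOV-Z_x, PCOV-Z_y, all at `F = 1{b ∈ ·}`** (plus the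
  certificate point and the pocket designation, as in `block41_three_of_pcov`): Question 8 at `|A| = 3` / MC-D@3 is the conjunction of four
  census-clean covariance comparisons of one shape (prim-lf-2 gen 16–17: 0 violations, n ≤ 9).
[cite: KozmaNitzan2024, Questions 8–9 (§5.5 p. 36), display (41), §5.1 (pp. 31–32)] [cite: VandenbergHaggstromKahn2005, §2.1 Lemma 2.4 (p. 10), Thm. 2.1 (p. 9)]
-/

namespace Summit.CriticalPhenomena.PercolationContinuityZ3.Theorems

open MeasureTheory Set Literature.Probability.LatticeModels Literature.Probability.Percolation
open scoped Classical
open KNPreFKG BHK2006 DecisionTree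

noncomputable section

namespace PocketCert

variable {V : Type*} [Fintype V]

/-- **(BHK-Z) for every pocket family.**  `𝒟` down-closed, no member containing `y` or `z`, `P = {C_o ∈ 𝒟}`, `E1 = {x↮y} ∩ {x↮z}`,
`W1 = {x↔o} ∩ E1`, `F` monotone: `μ(P ∩ E1) · ∫_{W1} F(C z) ≤ μ(W1) · ∫_{P ∩ E1} F(C z)`.  Dual form of `attach_of_pocket_union`.
[cite: VandenbergHaggstromKahn2005, §2.1 Lemma 2.4 (p. 10), Thm. 2.1 (p. 9)] [cite: KozmaNitzan2024, Questions 8–9 (§5.5 p. 36)] -/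
theorem attachZ_of_pocket (w : Sym2 V → unitInterval) (o x y z : V) (𝒟 : Set (Set V)) (h𝒟 : IsLowerSet 𝒟)
    (hy : ∀ W ∈ 𝒟, y ∉ W) (hz : ∀ W ∈ 𝒟, z ∉ W) (F : Set V → ℝ) (hF : ∀ S T : Set V, S ⊆ T → F S ≤ F T) :
    (prodBernoulli w).real ({ω : BondConfig V | openCluster ω o ∈ 𝒟} ∩
          ({ω | ¬ (openGraph ω).Reachable x y} ∩ {ω | ¬ (openGraph ω).Reachable x z})) *
        ∫ ω in openConn x o ∩ {ω | ¬ (openGraph ω).Reachable x y} ∩ {ω | ¬ (openGraph ω).Reachable x z},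
          F (openCluster ω z) ∂(prodBernoulli w) ≤
      (prodBernoulli w).real (openConn x o ∩ {ω | ¬ (openGraph ω).Reachable x y} ∩ {ω | ¬ (openGraph ω).Reachable x z}) *
        ∫ ω in {ω : BondConfig V | openCluster ω o ∈ 𝒟} ∩ ({ω | ¬ (openGraph ω).Reachable x y} ∩ {ω | ¬ (openGraph ω).Reachable x z}),
          F (openCluster ω z) ∂(prodBernoulli w) := by
  classical
  set μ := prodBernoulli w with hμ
  set D : Set (BondConfig V) := {ω | ¬ (openGraph ω).Reachable x z} with hD
  set P : Set (BondConfig V) := {ω : BondConfig V | openCluster ω o ∈ 𝒟} with hP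
  set G : Set V → ℝ := fun T => - ∫ η, F (openCluster (η \ {e : Sym2 V | ∃ v ∈ e, v ∈ T}) z) ∂μ with hG
  have hGmono : ∀ S T : Set V, S ⊆ T → G S ≤ G T := fun S T hST =>
    neg_le_neg (Q7Psi.condMean_antitone w z F hF S T hST)
  have hB := attach_of_pocket_union w o x y z 𝒟 h𝒟 hy hz G hGmono
  -- the observer world as a `σ(C_x)`-event inside `D`
  set 𝒮₁ : Set (Set (Sym2 V)) := {K | (o = x ∨ ∃ e ∈ K, o ∈ e) ∧ ¬ (y = x ∨ ∃ e ∈ K, y ∈ e)} with h𝒮₁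
  have hE1 : openConn x o ∩ {ω | ¬ (openGraph ω).Reachable x y} ∩ D = D ∩ {ω | openEdgeCluster ω x ∈ 𝒮₁} := by
    ext ω
    simp only [mem_inter_iff, openConn, mem_setOf_eq, h𝒮₁, reachable_iff_exists_mem_openEdgeCluster ω x o,
      reachable_iff_exists_mem_openEdgeCluster ω x y]
    tauto
  have i1 : ∫ ω in openConn x o ∩ {ω | ¬ (openGraph ω).Reachable x y} ∩ D, F (openCluster ω z) ∂μ =
      - ∫ ω in openConn x o ∩ {ω | ¬ (openGraph ω).Reachable x y} ∩ D, G (openCluster ω x) ∂μ := by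
    rw [hE1, hμ, hD, Q7Psi.tower_weak w x z F 𝒮₁, ← integral_neg]
    refine setIntegral_congr_fun MeasurableSet.of_discrete fun ω _ => ?_
    simp only [hG, neg_neg, hμ]
  -- the pocket cell as an event of the cluster of `{x, o}` inside `{{x,o} ↮ z}`
  set S : Set V := {x, o} with hS
  have hxS : x ∈ S := by simp [hS]
  have hoS : o ∈ S := by simp [hS]
  set DS : Set (BondConfig V) := {ω : BondConfig V | ∀ s ∈ S, ¬ (openGraph ω).Reachable s z} with hDS
  set E : Set (BondConfig V) := P ∩ ({ω | ¬ (openGraph ω).Reachable x y} ∩ D) with hE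
  set 𝒮₀ : Set (Set (Sym2 V)) := {K | ∃ ω' : BondConfig V, ω' ∈ E ∧ setCl ω' S = K} with h𝒮₀
  have hE0 : E = DS ∩ {ω | setCl ω S ∈ 𝒮₀} := by
    ext ω
    constructor
    · rintro hω
      refine ⟨?_, ⟨ω, hω, rfl⟩⟩
      simp only [hDS, hS, mem_setOf_eq, mem_insert_iff, mem_singleton_iff, forall_eq_or_imp, forall_eq]
      exact ⟨hω.2.2, fun hoz => hz _ hω.1 hoz⟩
    · rintro ⟨-, ⟨ω', ⟨hω'P, hω'y, hω'D⟩, hK⟩⟩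
      refine ⟨?_, ?_, ?_⟩
      · change openCluster ω o ∈ 𝒟
        rw [← openCluster_eq_of_setCl_eq hoS hK]; exact hω'P
      · change ¬ (openGraph ω).Reachable x y
        rw [← reachable_iff_of_setCl_eq hxS hK y]; exact hω'y
      · change ¬ (openGraph ω).Reachable x z
        rw [← reachable_iff_of_setCl_eq hxS hK z]; exact hω'D
  have i0 : ∫ ω in E, F (openCluster ω z) ∂μ = - ∫ ω in E, G (openCluster ω x ∪ openCluster ω o) ∂μ := by
    rw [hE0, hμ, hDS, tower_setCl w S z F 𝒮₀, ← integral_neg]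
    refine setIntegral_congr_fun MeasurableSet.of_discrete fun ω _ => ?_
    simp only [hG, neg_neg, hS, barOf_setCl_pair, hμ]
  have hn := fun (S' : Set (BondConfig V)) => (measureReal_nonneg : 0 ≤ μ.real S')
  change μ.real E * ∫ ω in openConn x o ∩ {ω | ¬ (openGraph ω).Reachable x y} ∩ D, F (openCluster ω z) ∂μ ≤
    μ.real (openConn x o ∩ {ω | ¬ (openGraph ω).Reachable x y} ∩ D) * ∫ ω in E, F (openCluster ω z) ∂μ
  change μ.real (openConn x o ∩ {ω | ¬ (openGraph ω).Reachable x y} ∩ D) * ∫ ω in E, G (openCluster ω x ∪ openCluster ω o) ∂μ ≤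
    μ.real E * ∫ ω in openConn x o ∩ {ω | ¬ (openGraph ω).Reachable x y} ∩ D, G (openCluster ω x) ∂μ at hB
  rw [i0, i1]
  nlinarith [hB, hn E, hn (openConn x o ∩ {ω | ¬ (openGraph ω).Reachable x y} ∩ D)]

/-- **The `x`-part of (Z*D) from (BHK-Z) and PCOV-Z_x** (real arithmetic `p1star_pocket_of_pieces` on the negated integrals of
`F(C z)`; notation of the file header, `J_E = ∫_E F(C z)`).
[cite: KozmaNitzan2024, §5.1 (pp. 31–32), Questions 8–9 (§5.5 p. 36)] -/
theorem zhalfZ_of_pcovZ (w : Sym2 V → unitInterval) (o x y z : V) (𝒟 : Set (Set V)) (h𝒟 : IsLowerSet 𝒟)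
    (hy : ∀ W ∈ 𝒟, y ∉ W) (hz : ∀ W ∈ 𝒟, z ∉ W) (F : Set V → ℝ) (hF : ∀ S T : Set V, S ⊆ T → F S ≤ F T)
    (b mDE2 d t lam : ℝ) (ht0 : 0 ≤ t) (ht1 : t ≤ 1)
    (hE1 : 0 < (prodBernoulli w).real ({ω : BondConfig V | openCluster ω o ∈ 𝒟} ∩
      ({ω | ¬ (openGraph ω).Reachable x y} ∩ {ω | ¬ (openGraph ω).Reachable x z})))
    (hE2 : 0 < mDE2)
    (ht : t * ((prodBernoulli w).real (openConn x o ∩ {ω | ¬ (openGraph ω).Reachable x y} ∩ {ω | ¬ (openGraph ω).Reachable x z}) * mDE2 +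
        b * (prodBernoulli w).real ({ω : BondConfig V | openCluster ω o ∈ 𝒟} ∩
          ({ω | ¬ (openGraph ω).Reachable x y} ∩ {ω | ¬ (openGraph ω).Reachable x z}))) =
      (prodBernoulli w).real (openConn x o ∩ {ω | ¬ (openGraph ω).Reachable x y} ∩ {ω | ¬ (openGraph ω).Reachable x z}) * mDE2)
    (hlam : lam * ((prodBernoulli w).real ({ω : BondConfig V | openCluster ω o ∈ 𝒟} ∩
          ({ω | ¬ (openGraph ω).Reachable x y} ∩ {ω | ¬ (openGraph ω).Reachable x z})) +
        (prodBernoulli w).real ({ω : BondConfig V | openCluster ω o ∈ 𝒟} ∩ (openConn x y ∩ {ω | ¬ (openGraph ω).Reachable x z}))) =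
      (prodBernoulli w).real (openConn x o ∩ {ω | ¬ (openGraph ω).Reachable x y} ∩ {ω | ¬ (openGraph ω).Reachable x z}) + t * d)
    (hPZ : mDE2 * (((prodBernoulli w).real ({ω : BondConfig V | openCluster ω o ∈ 𝒟} ∩
              ({ω | ¬ (openGraph ω).Reachable x y} ∩ {ω | ¬ (openGraph ω).Reachable x z})) +
            (prodBernoulli w).real ({ω : BondConfig V | openCluster ω o ∈ 𝒟} ∩ (openConn x y ∩ {ω | ¬ (openGraph ω).Reachable x z}))) *
          ((∫ ω in openConn x o ∩ {ω | ¬ (openGraph ω).Reachable x y} ∩ {ω | ¬ (openGraph ω).Reachable x z},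
              F (openCluster ω z) ∂(prodBernoulli w)) +
            ∫ ω in openConn x o ∩ openConn x y ∩ {ω | ¬ (openGraph ω).Reachable x z}, F (openCluster ω z) ∂(prodBernoulli w)) -
          ((prodBernoulli w).real (openConn x o ∩ {ω | ¬ (openGraph ω).Reachable x y} ∩ {ω | ¬ (openGraph ω).Reachable x z}) + d) *
          ((∫ ω in {ω : BondConfig V | openCluster ω o ∈ 𝒟} ∩ ({ω | ¬ (openGraph ω).Reachable x y} ∩ {ω | ¬ (openGraph ω).Reachable x z}),
              F (openCluster ω z) ∂(prodBernoulli w)) +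
            ∫ ω in {ω : BondConfig V | openCluster ω o ∈ 𝒟} ∩ (openConn x y ∩ {ω | ¬ (openGraph ω).Reachable x z}),
              F (openCluster ω z) ∂(prodBernoulli w))) ≤
      b * ((prodBernoulli w).real ({ω : BondConfig V | openCluster ω o ∈ 𝒟} ∩
              ({ω | ¬ (openGraph ω).Reachable x y} ∩ {ω | ¬ (openGraph ω).Reachable x z})) *
            (∫ ω in {ω : BondConfig V | openCluster ω o ∈ 𝒟} ∩ (openConn x y ∩ {ω | ¬ (openGraph ω).Reachable x z}),
              F (openCluster ω z) ∂(prodBernoulli w)) -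
          (prodBernoulli w).real ({ω : BondConfig V | openCluster ω o ∈ 𝒟} ∩ (openConn x y ∩ {ω | ¬ (openGraph ω).Reachable x z})) *
            (∫ ω in {ω : BondConfig V | openCluster ω o ∈ 𝒟} ∩ ({ω | ¬ (openGraph ω).Reachable x y} ∩ {ω | ¬ (openGraph ω).Reachable x z}),
              F (openCluster ω z) ∂(prodBernoulli w)))) :
    (∫ ω in openConn x o ∩ {ω | ¬ (openGraph ω).Reachable x y} ∩ {ω | ¬ (openGraph ω).Reachable x z},
        F (openCluster ω z) ∂(prodBernoulli w)) +
      t * ∫ ω in openConn x o ∩ openConn x y ∩ {ω | ¬ (openGraph ω).Reachable x z}, F (openCluster ω z) ∂(prodBernoulli w) ≤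
      lam * ((∫ ω in {ω : BondConfig V | openCluster ω o ∈ 𝒟} ∩ ({ω | ¬ (openGraph ω).Reachable x y} ∩ {ω | ¬ (openGraph ω).Reachable x z}),
              F (openCluster ω z) ∂(prodBernoulli w)) +
            ∫ ω in {ω : BondConfig V | openCluster ω o ∈ 𝒟} ∩ (openConn x y ∩ {ω | ¬ (openGraph ω).Reachable x z}),
              F (openCluster ω z) ∂(prodBernoulli w)) := by
  classical
  set μ := prodBernoulli w with hμ
  have hn := fun (S' : Set (BondConfig V)) => (measureReal_nonneg : 0 ≤ μ.real S')
  set W1 : Set (BondConfig V) := openConn x o ∩ {ω | ¬ (openGraph ω).Reachable x y} ∩ {ω | ¬ (openGraph ω).Reachable x z} with hW1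
  set W3 : Set (BondConfig V) := openConn x o ∩ openConn x y ∩ {ω | ¬ (openGraph ω).Reachable x z} with hW3
  set PE1 : Set (BondConfig V) := {ω : BondConfig V | openCluster ω o ∈ 𝒟} ∩
      ({ω | ¬ (openGraph ω).Reachable x y} ∩ {ω | ¬ (openGraph ω).Reachable x z}) with hPE1
  set PF : Set (BondConfig V) := {ω : BondConfig V | openCluster ω o ∈ 𝒟} ∩ (openConn x y ∩ {ω | ¬ (openGraph ω).Reachable x z}) with hPF
  have hBZ := attachZ_of_pocket w o x y z 𝒟 h𝒟 hy hz F hF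
  change μ.real PE1 * ∫ ω in W1, F (openCluster ω z) ∂μ ≤ μ.real W1 * ∫ ω in PE1, F (openCluster ω z) ∂μ at hBZ
  have h := p1star_pocket_of_pieces (- ∫ ω in W1, F (openCluster ω z) ∂μ) (- ∫ ω in W3, F (openCluster ω z) ∂μ)
    (- ∫ ω in PE1, F (openCluster ω z) ∂μ) (- ∫ ω in PF, F (openCluster ω z) ∂μ) (μ.real W1) d b (μ.real PE1) (μ.real PF) mDE2
    t lam ht0 ht1 hE1 hE2 (hn _) ht hlam (by linarith) (by linarith)
  linarith

/-- **(41) for three relays from the FOUR covariance comparisons PCOV_x, PCOV_y, PCOV-Z_x, PCOV-Z_y at `F = 1{b ∈ ·}`** (notation and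
remaining hypotheses — non-degeneracy, certificate point `(t, λ, μ)`, pocket designation — verbatim as in `block41_three_of_pcov`, whose
hypothesis (Z*D) is replaced by `hPZx`, `hPZy`).
[cite: KozmaNitzan2024, Questions 8–9 (§5.5 p. 36), display (41)] [cite: VandenbergHaggstromKahn2005, §2.1 Lemma 2.4 (p. 10), Thm. 2.1 (p. 9)] -/
theorem block41_three_of_pcovZ (w : Sym2 V → unitInterval) (o b x y z : V) (𝒟 : Set (Set V)) (h𝒟 : IsLowerSet 𝒟)
    (hx𝒟 : ∀ W ∈ 𝒟, x ∉ W) (hy𝒟 : ∀ W ∈ 𝒟, y ∉ W) (hz𝒟 : ∀ W ∈ 𝒟, z ∉ W) (t lam mu : ℝ) (ht0 : 0 ≤ t) (ht1 : t ≤ 1)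
    (hE1 : 0 < (prodBernoulli w).real ({ω : BondConfig V | openCluster ω o ∈ 𝒟} ∩
      ({ω | ¬ (openGraph ω).Reachable x y} ∩ {ω | ¬ (openGraph ω).Reachable x z})))
    (hE2 : 0 < (prodBernoulli w).real ({ω : BondConfig V | openCluster ω o ∈ 𝒟} ∩
      ({ω | ¬ (openGraph ω).Reachable y x} ∩ {ω | ¬ (openGraph ω).Reachable y z})))
    (ht : t * ((prodBernoulli w).real (openConn x o ∩ {ω | ¬ (openGraph ω).Reachable x y} ∩ {ω | ¬ (openGraph ω).Reachable x z}) *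
          (prodBernoulli w).real ({ω : BondConfig V | openCluster ω o ∈ 𝒟} ∩
            ({ω | ¬ (openGraph ω).Reachable y x} ∩ {ω | ¬ (openGraph ω).Reachable y z})) +
        (prodBernoulli w).real (openConn y o ∩ {ω | ¬ (openGraph ω).Reachable y x} ∩ {ω | ¬ (openGraph ω).Reachable y z}) *
          (prodBernoulli w).real ({ω : BondConfig V | openCluster ω o ∈ 𝒟} ∩
            ({ω | ¬ (openGraph ω).Reachable x y} ∩ {ω | ¬ (openGraph ω).Reachable x z}))) =
      (prodBernoulli w).real (openConn x o ∩ {ω | ¬ (openGraph ω).Reachable x y} ∩ {ω | ¬ (openGraph ω).Reachable x z}) *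
        (prodBernoulli w).real ({ω : BondConfig V | openCluster ω o ∈ 𝒟} ∩
          ({ω | ¬ (openGraph ω).Reachable y x} ∩ {ω | ¬ (openGraph ω).Reachable y z})))
    (hlam : lam * (prodBernoulli w).real ({ω : BondConfig V | openCluster ω o ∈ 𝒟} ∩ {ω | ¬ (openGraph ω).Reachable x z}) =
      (prodBernoulli w).real (openConn x o ∩ {ω | ¬ (openGraph ω).Reachable x y} ∩ {ω | ¬ (openGraph ω).Reachable x z}) +
        t * (prodBernoulli w).real (openConn x o ∩ openConn x y ∩ {ω | ¬ (openGraph ω).Reachable x z}))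
    (hmu : mu * (prodBernoulli w).real ({ω : BondConfig V | openCluster ω o ∈ 𝒟} ∩ {ω | ¬ (openGraph ω).Reachable y z}) =
      (prodBernoulli w).real (openConn y o ∩ {ω | ¬ (openGraph ω).Reachable y x} ∩ {ω | ¬ (openGraph ω).Reachable y z}) +
        (1 - t) * (prodBernoulli w).real (openConn y o ∩ openConn y x ∩ {ω | ¬ (openGraph ω).Reachable y z}))
    (hPx : (prodBernoulli w).real (openConn y o ∩ {ω | ¬ (openGraph ω).Reachable y x} ∩ {ω | ¬ (openGraph ω).Reachable y z}) *
        ((prodBernoulli w).real ({ω : BondConfig V | openCluster ω o ∈ 𝒟} ∩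
              ({ω | ¬ (openGraph ω).Reachable x y} ∩ {ω | ¬ (openGraph ω).Reachable x z})) *
            (prodBernoulli w).real ({ω : BondConfig V | openCluster ω o ∈ 𝒟} ∩
              (openConn x y ∩ {ω | ¬ (openGraph ω).Reachable x z}) ∩ openConn x b) -
          (prodBernoulli w).real ({ω : BondConfig V | openCluster ω o ∈ 𝒟} ∩
              (openConn x y ∩ {ω | ¬ (openGraph ω).Reachable x z})) *
            (prodBernoulli w).real ({ω : BondConfig V | openCluster ω o ∈ 𝒟} ∩
              ({ω | ¬ (openGraph ω).Reachable x y} ∩ {ω | ¬ (openGraph ω).Reachable x z}) ∩ openConn x b)) ≤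
      (prodBernoulli w).real ({ω : BondConfig V | openCluster ω o ∈ 𝒟} ∩
          ({ω | ¬ (openGraph ω).Reachable y x} ∩ {ω | ¬ (openGraph ω).Reachable y z})) *
        (((prodBernoulli w).real ({ω : BondConfig V | openCluster ω o ∈ 𝒟} ∩
                ({ω | ¬ (openGraph ω).Reachable x y} ∩ {ω | ¬ (openGraph ω).Reachable x z})) +
              (prodBernoulli w).real ({ω : BondConfig V | openCluster ω o ∈ 𝒟} ∩
                (openConn x y ∩ {ω | ¬ (openGraph ω).Reachable x z}))) *
            ((prodBernoulli w).real (openConn x o ∩ {ω | ¬ (openGraph ω).Reachable x y} ∩ {ω | ¬ (openGraph ω).Reachable x z} ∩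
                openConn x b) +
              (prodBernoulli w).real (openConn x o ∩ openConn x y ∩ {ω | ¬ (openGraph ω).Reachable x z} ∩ openConn x b)) -
          ((prodBernoulli w).real (openConn x o ∩ {ω | ¬ (openGraph ω).Reachable x y} ∩ {ω | ¬ (openGraph ω).Reachable x z}) +
              (prodBernoulli w).real (openConn x o ∩ openConn x y ∩ {ω | ¬ (openGraph ω).Reachable x z})) *
            ((prodBernoulli w).real ({ω : BondConfig V | openCluster ω o ∈ 𝒟} ∩
                ({ω | ¬ (openGraph ω).Reachable x y} ∩ {ω | ¬ (openGraph ω).Reachable x z}) ∩ openConn x b) +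
              (prodBernoulli w).real ({ω : BondConfig V | openCluster ω o ∈ 𝒟} ∩
                (openConn x y ∩ {ω | ¬ (openGraph ω).Reachable x z}) ∩ openConn x b))))
    (hPy : (prodBernoulli w).real (openConn x o ∩ {ω | ¬ (openGraph ω).Reachable x y} ∩ {ω | ¬ (openGraph ω).Reachable x z}) *
        ((prodBernoulli w).real ({ω : BondConfig V | openCluster ω o ∈ 𝒟} ∩
              ({ω | ¬ (openGraph ω).Reachable y x} ∩ {ω | ¬ (openGraph ω).Reachable y z})) *
            (prodBernoulli w).real ({ω : BondConfig V | openCluster ω o ∈ 𝒟} ∩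
              (openConn y x ∩ {ω | ¬ (openGraph ω).Reachable y z}) ∩ openConn y b) -
          (prodBernoulli w).real ({ω : BondConfig V | openCluster ω o ∈ 𝒟} ∩
              (openConn y x ∩ {ω | ¬ (openGraph ω).Reachable y z})) *
            (prodBernoulli w).real ({ω : BondConfig V | openCluster ω o ∈ 𝒟} ∩
              ({ω | ¬ (openGraph ω).Reachable y x} ∩ {ω | ¬ (openGraph ω).Reachable y z}) ∩ openConn y b)) ≤
      (prodBernoulli w).real ({ω : BondConfig V | openCluster ω o ∈ 𝒟} ∩
          ({ω | ¬ (openGraph ω).Reachable x y} ∩ {ω | ¬ (openGraph ω).Reachable x z})) *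
        (((prodBernoulli w).real ({ω : BondConfig V | openCluster ω o ∈ 𝒟} ∩
                ({ω | ¬ (openGraph ω).Reachable y x} ∩ {ω | ¬ (openGraph ω).Reachable y z})) +
              (prodBernoulli w).real ({ω : BondConfig V | openCluster ω o ∈ 𝒟} ∩
                (openConn y x ∩ {ω | ¬ (openGraph ω).Reachable y z}))) *
            ((prodBernoulli w).real (openConn y o ∩ {ω | ¬ (openGraph ω).Reachable y x} ∩ {ω | ¬ (openGraph ω).Reachable y z} ∩
                openConn y b) +
              (prodBernoulli w).real (openConn y o ∩ openConn y x ∩ {ω | ¬ (openGraph ω).Reachable y z} ∩ openConn y b)) -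
          ((prodBernoulli w).real (openConn y o ∩ {ω | ¬ (openGraph ω).Reachable y x} ∩ {ω | ¬ (openGraph ω).Reachable y z}) +
              (prodBernoulli w).real (openConn y o ∩ openConn y x ∩ {ω | ¬ (openGraph ω).Reachable y z})) *
            ((prodBernoulli w).real ({ω : BondConfig V | openCluster ω o ∈ 𝒟} ∩
                ({ω | ¬ (openGraph ω).Reachable y x} ∩ {ω | ¬ (openGraph ω).Reachable y z}) ∩ openConn y b) +
              (prodBernoulli w).real ({ω : BondConfig V | openCluster ω o ∈ 𝒟} ∩
                (openConn y x ∩ {ω | ¬ (openGraph ω).Reachable y z}) ∩ openConn y b))))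
    (hPZx : (prodBernoulli w).real ({ω : BondConfig V | openCluster ω o ∈ 𝒟} ∩
          ({ω | ¬ (openGraph ω).Reachable y x} ∩ {ω | ¬ (openGraph ω).Reachable y z})) *
        (((prodBernoulli w).real ({ω : BondConfig V | openCluster ω o ∈ 𝒟} ∩
                ({ω | ¬ (openGraph ω).Reachable x y} ∩ {ω | ¬ (openGraph ω).Reachable x z})) +
              (prodBernoulli w).real ({ω : BondConfig V | openCluster ω o ∈ 𝒟} ∩
                (openConn x y ∩ {ω | ¬ (openGraph ω).Reachable x z}))) *
            ((prodBernoulli w).real (openConn x o ∩ {ω | ¬ (openGraph ω).Reachable x y} ∩ {ω | ¬ (openGraph ω).Reachable x z} ∩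
                openConn z b) +
              (prodBernoulli w).real (openConn x o ∩ openConn x y ∩ {ω | ¬ (openGraph ω).Reachable x z} ∩ openConn z b)) -
          ((prodBernoulli w).real (openConn x o ∩ {ω | ¬ (openGraph ω).Reachable x y} ∩ {ω | ¬ (openGraph ω).Reachable x z}) +
              (prodBernoulli w).real (openConn x o ∩ openConn x y ∩ {ω | ¬ (openGraph ω).Reachable x z})) *
            ((prodBernoulli w).real ({ω : BondConfig V | openCluster ω o ∈ 𝒟} ∩
                ({ω | ¬ (openGraph ω).Reachable x y} ∩ {ω | ¬ (openGraph ω).Reachable x z}) ∩ openConn z b) +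
              (prodBernoulli w).real ({ω : BondConfig V | openCluster ω o ∈ 𝒟} ∩
                (openConn x y ∩ {ω | ¬ (openGraph ω).Reachable x z}) ∩ openConn z b))) ≤
      (prodBernoulli w).real (openConn y o ∩ {ω | ¬ (openGraph ω).Reachable y x} ∩ {ω | ¬ (openGraph ω).Reachable y z}) *
        ((prodBernoulli w).real ({ω : BondConfig V | openCluster ω o ∈ 𝒟} ∩
              ({ω | ¬ (openGraph ω).Reachable x y} ∩ {ω | ¬ (openGraph ω).Reachable x z})) *
            (prodBernoulli w).real ({ω : BondConfig V | openCluster ω o ∈ 𝒟} ∩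
              (openConn x y ∩ {ω | ¬ (openGraph ω).Reachable x z}) ∩ openConn z b) -
          (prodBernoulli w).real ({ω : BondConfig V | openCluster ω o ∈ 𝒟} ∩
              (openConn x y ∩ {ω | ¬ (openGraph ω).Reachable x z})) *
            (prodBernoulli w).real ({ω : BondConfig V | openCluster ω o ∈ 𝒟} ∩
              ({ω | ¬ (openGraph ω).Reachable x y} ∩ {ω | ¬ (openGraph ω).Reachable x z}) ∩ openConn z b)))
    (hPZy : (prodBernoulli w).real ({ω : BondConfig V | openCluster ω o ∈ 𝒟} ∩
          ({ω | ¬ (openGraph ω).Reachable x y} ∩ {ω | ¬ (openGraph ω).Reachable x z})) *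
        (((prodBernoulli w).real ({ω : BondConfig V | openCluster ω o ∈ 𝒟} ∩
                ({ω | ¬ (openGraph ω).Reachable y x} ∩ {ω | ¬ (openGraph ω).Reachable y z})) +
              (prodBernoulli w).real ({ω : BondConfig V | openCluster ω o ∈ 𝒟} ∩
                (openConn y x ∩ {ω | ¬ (openGraph ω).Reachable y z}))) *
            ((prodBernoulli w).real (openConn y o ∩ {ω | ¬ (openGraph ω).Reachable y x} ∩ {ω | ¬ (openGraph ω).Reachable y z} ∩
                openConn z b) +
              (prodBernoulli w).real (openConn y o ∩ openConn y x ∩ {ω | ¬ (openGraph ω).Reachable y z} ∩ openConn z b)) -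
          ((prodBernoulli w).real (openConn y o ∩ {ω | ¬ (openGraph ω).Reachable y x} ∩ {ω | ¬ (openGraph ω).Reachable y z}) +
              (prodBernoulli w).real (openConn y o ∩ openConn y x ∩ {ω | ¬ (openGraph ω).Reachable y z})) *
            ((prodBernoulli w).real ({ω : BondConfig V | openCluster ω o ∈ 𝒟} ∩
                ({ω | ¬ (openGraph ω).Reachable y x} ∩ {ω | ¬ (openGraph ω).Reachable y z}) ∩ openConn z b) +
              (prodBernoulli w).real ({ω : BondConfig V | openCluster ω o ∈ 𝒟} ∩
                (openConn y x ∩ {ω | ¬ (openGraph ω).Reachable y z}) ∩ openConn z b))) ≤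
      (prodBernoulli w).real (openConn x o ∩ {ω | ¬ (openGraph ω).Reachable x y} ∩ {ω | ¬ (openGraph ω).Reachable x z}) *
        ((prodBernoulli w).real ({ω : BondConfig V | openCluster ω o ∈ 𝒟} ∩
              ({ω | ¬ (openGraph ω).Reachable y x} ∩ {ω | ¬ (openGraph ω).Reachable y z})) *
            (prodBernoulli w).real ({ω : BondConfig V | openCluster ω o ∈ 𝒟} ∩
              (openConn y x ∩ {ω | ¬ (openGraph ω).Reachable y z}) ∩ openConn z b) -
          (prodBernoulli w).real ({ω : BondConfig V | openCluster ω o ∈ 𝒟} ∩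
              (openConn y x ∩ {ω | ¬ (openGraph ω).Reachable y z})) *
            (prodBernoulli w).real ({ω : BondConfig V | openCluster ω o ∈ 𝒟} ∩
              ({ω | ¬ (openGraph ω).Reachable y x} ∩ {ω | ¬ (openGraph ω).Reachable y z}) ∩ openConn z b)))
    (hzx : (prodBernoulli w).real ({ω : BondConfig V | openCluster ω o ∈ 𝒟} ∩ openConn z b) ≤
      (prodBernoulli w).real ({ω : BondConfig V | openCluster ω o ∈ 𝒟} ∩ openConn x b))
    (hzy : (prodBernoulli w).real ({ω : BondConfig V | openCluster ω o ∈ 𝒟} ∩ openConn z b) ≤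
      (prodBernoulli w).real ({ω : BondConfig V | openCluster ω o ∈ 𝒟} ∩ openConn y b)) :
    (prodBernoulli w).real (openConn z b ∩ (openConn o x ∪ openConn o y ∪ openConn o z)) ≤
      (prodBernoulli w).real (openConn o b ∩ (openConn o x ∪ openConn o y ∪ openConn o z)) := by
  classical
  set μ := prodBernoulli w with hμ
  have hmeas : ∀ S : Set (BondConfig V), MeasurableSet S := fun _ => MeasurableSet.of_discrete
  have hn := fun (S : Set (BondConfig V)) => (measureReal_nonneg : 0 ≤ μ.real S)
  have hint : ∀ (g : BondConfig V → ℝ) (S : Set (BondConfig V)), IntegrableOn g S μ :=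
    fun g S => (Integrable.of_finite).integrableOn
  set P : Set (BondConfig V) := {ω : BondConfig V | openCluster ω o ∈ 𝒟} with hP
  set E1x : Set (BondConfig V) := {ω : BondConfig V | ¬ (openGraph ω).Reachable x y} ∩ {ω | ¬ (openGraph ω).Reachable x z} with hE1x
  set Fx : Set (BondConfig V) := openConn x y ∩ {ω : BondConfig V | ¬ (openGraph ω).Reachable x z} with hFx
  set E2y : Set (BondConfig V) := {ω : BondConfig V | ¬ (openGraph ω).Reachable y x} ∩ {ω | ¬ (openGraph ω).Reachable y z} with hE2y
  set Fy : Set (BondConfig V) := openConn y x ∩ {ω : BondConfig V | ¬ (openGraph ω).Reachable y z} with hFy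
  set W1 : Set (BondConfig V) := openConn x o ∩ {ω | ¬ (openGraph ω).Reachable x y} ∩ {ω | ¬ (openGraph ω).Reachable x z} with hW1
  set W2 : Set (BondConfig V) := openConn y o ∩ {ω | ¬ (openGraph ω).Reachable y x} ∩ {ω | ¬ (openGraph ω).Reachable y z} with hW2
  set W3x : Set (BondConfig V) := openConn x o ∩ openConn x y ∩ {ω | ¬ (openGraph ω).Reachable x z} with hW3x
  set W3y : Set (BondConfig V) := openConn y o ∩ openConn y x ∩ {ω | ¬ (openGraph ω).Reachable y z} with hW3y
  set J' : Set (BondConfig V) := (openConn o x ∪ openConn o y) ∩ {ω | ¬ (openGraph ω).Reachable o z} with hJ'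
  set F : Set V → ℝ := fun T => T.indicator (1 : V → ℝ) b with hF
  have hFmono : ∀ S T : Set V, S ⊆ T → F S ≤ F T := fun S T hST =>
    Set.indicator_le_indicator_of_subset hST (fun _ => zero_le_one) b
  have hI : ∀ (v : V) (S : Set (BondConfig V)), ∫ ω in S, F (openCluster ω v) ∂μ = μ.real (S ∩ openConn v b) :=
    fun v S => setIntegral_indicator_openCluster μ b v S
  have hsetx : P ∩ {ω | ¬ (openGraph ω).Reachable x z} = (P ∩ E1x) ∪ (P ∩ Fx) := by
    ext ω
    simp only [hE1x, hFx, mem_inter_iff, mem_union, mem_setOf_eq, openConn]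
    tauto
  have hdjx : Disjoint (P ∩ E1x) (P ∩ Fx) := by
    rw [Set.disjoint_left]
    rintro ω ⟨-, hxy, -⟩ ⟨-, hxy', -⟩
    exact hxy hxy'
  have hsety : P ∩ {ω | ¬ (openGraph ω).Reachable y z} = (P ∩ E2y) ∪ (P ∩ Fy) := by
    ext ω
    simp only [hE2y, hFy, mem_inter_iff, mem_union, mem_setOf_eq, openConn]
    tauto
  have hdjy : Disjoint (P ∩ E2y) (P ∩ Fy) := by
    rw [Set.disjoint_left]
    rintro ω ⟨-, hyx, -⟩ ⟨-, hyx', -⟩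
    exact hyx hyx'
  have massx : μ.real (P ∩ {ω | ¬ (openGraph ω).Reachable x z}) = μ.real (P ∩ E1x) + μ.real (P ∩ Fx) := by
    rw [hsetx, measureReal_union hdjx (hmeas _)]
  have massy : μ.real (P ∩ {ω | ¬ (openGraph ω).Reachable y z}) = μ.real (P ∩ E2y) + μ.real (P ∩ Fy) := by
    rw [hsety, measureReal_union hdjy (hmeas _)]
  have splitx : ∫ ω in P ∩ {ω | ¬ (openGraph ω).Reachable x z}, F (openCluster ω z) ∂μ =
      (∫ ω in P ∩ E1x, F (openCluster ω z) ∂μ) + ∫ ω in P ∩ Fx, F (openCluster ω z) ∂μ := by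
    rw [hsetx, setIntegral_union hdjx (hmeas _) (hint _ _) (hint _ _)]
  have splity : ∫ ω in P ∩ {ω | ¬ (openGraph ω).Reachable y z}, F (openCluster ω z) ∂μ =
      (∫ ω in P ∩ E2y, F (openCluster ω z) ∂μ) + ∫ ω in P ∩ Fy, F (openCluster ω z) ∂μ := by
    rw [hsety, setIntegral_union hdjy (hmeas _) (hint _ _) (hint _ _)]
  have hlam' : lam * (μ.real (P ∩ E1x) + μ.real (P ∩ Fx)) = μ.real W1 + t * μ.real W3x := by rw [← massx]; exact hlam
  have hmu' : mu * (μ.real (P ∩ E2y) + μ.real (P ∩ Fy)) = μ.real W2 + (1 - t) * μ.real W3y := by rw [← massy]; exact hmu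
  have ht' : (1 - t) * (μ.real W2 * μ.real (P ∩ E1x) + μ.real W1 * μ.real (P ∩ E2y)) = μ.real W2 * μ.real (P ∩ E1x) := by
    linear_combination (-1 : ℝ) * ht
  have hx := zhalfZ_of_pcovZ w o x y z 𝒟 h𝒟 hy𝒟 hz𝒟 F hFmono (μ.real W2) (μ.real (P ∩ E2y)) (μ.real W3x) t lam ht0 ht1 hE1 hE2
    ht hlam' (by rw [hI, hI, hI, hI]; exact hPZx)
  have hy := zhalfZ_of_pcovZ w o y x z 𝒟 h𝒟 hx𝒟 hz𝒟 F hFmono (μ.real W1) (μ.real (P ∩ E1x)) (μ.real W3y) (1 - t) mu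
    (by linarith) (by linarith) hE2 hE1 ht' hmu' (by rw [hI, hI, hI, hI]; exact hPZy)
  change (∫ ω in W1, F (openCluster ω z) ∂μ) + t * ∫ ω in W3x, F (openCluster ω z) ∂μ ≤
    lam * ((∫ ω in P ∩ E1x, F (openCluster ω z) ∂μ) + ∫ ω in P ∩ Fx, F (openCluster ω z) ∂μ) at hx
  change (∫ ω in W2, F (openCluster ω z) ∂μ) + (1 - t) * ∫ ω in W3y, F (openCluster ω z) ∂μ ≤
    mu * ((∫ ω in P ∩ E2y, F (openCluster ω z) ∂μ) + ∫ ω in P ∩ Fy, F (openCluster ω z) ∂μ) at hy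
  rw [← splitx] at hx; rw [← splity] at hy
  have h33 : W3x = W3y := by
    ext ω
    simp only [hW3x, hW3y, mem_inter_iff, mem_setOf_eq, openConn]
    constructor
    · rintro ⟨⟨hxo, hxy⟩, hxz⟩
      exact ⟨⟨hxy.symm.trans hxo, hxy.symm⟩, fun hyz => hxz (hxy.trans hyz)⟩
    · rintro ⟨⟨hyo, hyx⟩, hyz⟩
      exact ⟨⟨hyx.symm.trans hyo, hyx.symm⟩, fun hxz => hyz (hyx.trans hxz)⟩
  have hJeq : J' = (W1 ∪ W2) ∪ W3x := by
    ext ω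
    simp only [hJ', hW1, hW2, hW3x, mem_inter_iff, mem_union, mem_setOf_eq, openConn]
    constructor
    · rintro ⟨hJ, hoz⟩
      by_cases hox : (openGraph ω).Reachable o x
      · by_cases hxy : (openGraph ω).Reachable x y
        · exact Or.inr ⟨⟨hox.symm, hxy⟩, fun hxz => hoz (hox.trans hxz)⟩
        · exact Or.inl (Or.inl ⟨⟨hox.symm, hxy⟩, fun hxz => hoz (hox.trans hxz)⟩)
      · have hoy : (openGraph ω).Reachable o y := by
          rcases hJ with h | h
          · exact absurd h hox
          · exact h
        refine Or.inl (Or.inr ⟨⟨hoy.symm, fun hyx => hox (hoy.trans hyx)⟩, fun hyz => hoz (hoy.trans hyz)⟩)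
    · rintro ((⟨⟨hxo, _⟩, hxz⟩ | ⟨⟨hyo, _⟩, hyz⟩) | ⟨⟨hxo, _⟩, hxz⟩)
      · exact ⟨Or.inl hxo.symm, fun hoz => hxz (hxo.trans hoz)⟩
      · exact ⟨Or.inr hyo.symm, fun hoz => hyz (hyo.trans hoz)⟩
      · exact ⟨Or.inl hxo.symm, fun hoz => hxz (hxo.trans hoz)⟩
  have hd12 : Disjoint W1 W2 := by
    rw [Set.disjoint_left]
    rintro ω ⟨⟨hxo, hxy⟩, _⟩ ⟨⟨hyo, _⟩, _⟩
    exact hxy (SimpleGraph.Reachable.trans hxo (SimpleGraph.Reachable.symm hyo))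
  have hd123 : Disjoint (W1 ∪ W2) W3x := by
    rw [Set.disjoint_left]
    rintro ω (⟨⟨_, hxy⟩, _⟩ | ⟨⟨_, hyx⟩, _⟩) ⟨⟨_, hxy'⟩, _⟩
    · exact hxy hxy'
    · exact hyx (SimpleGraph.Reachable.symm hxy')
  have hsplit : ∫ ω in J', F (openCluster ω z) ∂μ =
      ∫ ω in W1, F (openCluster ω z) ∂μ + ∫ ω in W2, F (openCluster ω z) ∂μ + ∫ ω in W3x, F (openCluster ω z) ∂μ := by
    rw [hJeq, setIntegral_union hd123 (hmeas _) (hint _ _) (hint _ _), setIntegral_union hd12 (hmeas _) (hint _ _) (hint _ _)]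
  have hZ : ∫ ω in J', F (openCluster ω z) ∂μ ≤
      lam * (∫ ω in P ∩ {ω | ¬ (openGraph ω).Reachable x z}, F (openCluster ω z) ∂μ) +
        mu * (∫ ω in P ∩ {ω | ¬ (openGraph ω).Reachable y z}, F (openCluster ω z) ∂μ) := by
    rw [hsplit]; rw [← h33] at hy
    have e3 : ∫ ω in W3x, F (openCluster ω z) ∂μ =
        t * ∫ ω in W3x, F (openCluster ω z) ∂μ + (1 - t) * ∫ ω in W3x, F (openCluster ω z) ∂μ := by ring
    rw [e3]
    linarith [hx, hy]
  rw [hI, hI, hI] at hZ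
  exact block41_three_of_pcov w o b x y z 𝒟 h𝒟 hx𝒟 hy𝒟 hz𝒟 t lam mu ht0 ht1 hE1 hE2 ht hlam hmu hPx hPy hZ hzx hzy

end PocketCert

end

end Summit.CriticalPhenomena.PercolationContinuityZ3.Theorems
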